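import Literature.Analysis.Complex.HormanderL2Estimate
import Mathlib.Analysis.SpecialFunctions.SmoothTransition
import Mathlib.MeasureTheory.Integral.IntervalIntegral.FundThmCalculus
import Mathlib.Analysis.InnerProductSpace.Calculus
import HarnessLib

/-!
# Exhaustion functions, convex majorants and Hörmander's auxiliary weights on a Riemann domain

Layer `Literature/Analysis/Complex`; support file for the transplant of Hörmander's Lemma 4.4.1
(*An Introduction to Complex Analysis in Several Variables* (1973), §4.4, p. 92) to flat Riemann
domains. Given a `C^∞` exhaustion function `s` of a Riemann domain `D` (sublevel sets compact) we
construct the objects of the first paragraph of the proof of Lemma 4.4.1: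

* `exists_smooth_convex_majorant` — smooth convex nondecreasing `χ : ℝ → ℝ`, `χ = 0` on `(-∞, a]`,
  with `χ` and `χ'` exceeding prescribed constants on the unit intervals `[a+2+k, a+3+k]` («`χ` convex
  and so rapidly increasing that …»);
* flat chain rules: `dbar_ofReal_comp`, `del_ofReal_comp` (`∂̄ (χ ∘ s) = χ'(s) ∂̄ s`), and the Levi
  form of `χ ∘ s`, `re_levi_comp_ge` : `Re ∑ ∂_j∂̄_k(χ∘s) v_j v̄_k ≥ χ'(s) Re ∑ s_{jk̄} v_j v̄_k` for
  `χ'' ≥ 0`;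
* the cut-offs `η_ν = σ(ν + a + 4 - s)` and the auxiliary function
  `ψ_a = σ(s - a - 2) log(1 + C ∑_k |∂_k s|²)` (`σ` = `Real.smoothTransition`) with (4.2.2):
  `∑_k |∂̄_k η_ν|² ≤ e^{ψ_a}`, `ψ_a = 0` on `{s ≤ a + 2}`, `η_ν → 1` locally
  (`exhaustionCutoff`, `exhaustionPsi`, `sum_norm_dbar_exhaustionCutoff_sq_le`).

Everything is proved; no named facts.

## References

* L. Hörmander, *An Introduction to Complex Analysis in Several Variables* (1973), §4.2 (4.2.1)–(4.2.2)
  p. 82 and proof of Lemma 4.4.1, p. 92. [HormanderSCV1973]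

#harness_tags complex_analysis.several_variables, complex_analysis.l2_estimates, complex_geometry.riemann_existence
-/

noncomputable section

open scoped Manifold ContDiff Topology ComplexConjugate NNReal
open Set Filter Function Complex MeasureTheory intervalIntegral

namespace Literature.Analysis.Complex

namespace RiemannDomain

/-! ### A smooth convex step and smooth convex majorants on `ℝ` -/

section Majorant

/-- The primitive `S(r) = ∫_0^r σ` of the smooth transition `σ`: a `C^∞` convex nondecreasing function,
`0` on `(-∞, 0]`, with `S' = 1` on `[1, ∞)` and `S ≥ 1` on `[2, ∞)`. [folklore] -/
def stepPrim (r : ℝ) : ℝ := ∫ t in (0 : ℝ)..r, Real.smoothTransition t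

/-- `S' = σ`. [folklore] -/
theorem hasDerivAt_stepPrim (r : ℝ) : HasDerivAt stepPrim (Real.smoothTransition r) r :=
  integral_hasDerivAt_right (Real.smoothTransition.continuous.intervalIntegrable _ _)
    (Real.smoothTransition.continuous.stronglyMeasurableAtFilter _ _) Real.smoothTransition.continuousAt

/-- `S' = σ` as functions. [folklore] -/
theorem deriv_stepPrim : deriv stepPrim = Real.smoothTransition :=
  funext fun r ↦ (hasDerivAt_stepPrim r).deriv

/-- `S` is `C^∞`. [folklore] -/
theorem contDiff_stepPrim : ContDiff ℝ ∞ stepPrim :=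
  contDiff_infty_iff_deriv.2 ⟨fun r ↦ (hasDerivAt_stepPrim r).differentiableAt,
    by rw [deriv_stepPrim]; exact Real.smoothTransition.contDiff⟩

/-- `S = 0` on `(-∞, 0]`. [folklore] -/
theorem stepPrim_of_nonpos {r : ℝ} (h : r ≤ 0) : stepPrim r = 0 := by
  rw [stepPrim, integral_symm, neg_eq_zero]
  refine integral_zero_ae (ae_of_all _ fun t ht ↦ ?_)
  rw [uIoc_of_le h] at ht
  exact Real.smoothTransition.zero_of_nonpos ht.2

/-- `S` is monotone. [folklore] -/
theorem monotone_stepPrim : Monotone stepPrim :=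
  monotone_of_deriv_nonneg (fun r ↦ (hasDerivAt_stepPrim r).differentiableAt) fun r ↦ by
    rw [deriv_stepPrim]; exact Real.smoothTransition.nonneg r

/-- `S ≥ 0`. [folklore] -/
theorem stepPrim_nonneg (r : ℝ) : 0 ≤ stepPrim r := by
  rcases le_or_gt r 0 with h | h
  · rw [stepPrim_of_nonpos h]
  · rw [← stepPrim_of_nonpos le_rfl]; exact monotone_stepPrim h.le

/-- `S' = 1` on `[1, ∞)`. [folklore] -/
theorem deriv_stepPrim_eq_one {r : ℝ} (h : 1 ≤ r) : deriv stepPrim r = 1 := by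
  rw [deriv_stepPrim]; exact Real.smoothTransition.one_of_one_le h

/-- `S' ≥ 0`. [folklore] -/
theorem deriv_stepPrim_nonneg (r : ℝ) : 0 ≤ deriv stepPrim r := by
  rw [deriv_stepPrim]; exact Real.smoothTransition.nonneg r

/-- `S'' ≥ 0` (`σ` is monotone). [folklore] -/
theorem deriv_deriv_stepPrim_nonneg (r : ℝ) : 0 ≤ deriv (deriv stepPrim) r := by
  rw [deriv_stepPrim]
  exact Real.smoothTransition.monotone.deriv_nonneg

/-- `S ≥ 1` on `[2, ∞)`: `S(r) ≥ S(r) - S(1) = ∫_1^r 1 = r - 1`. [folklore] -/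
theorem one_le_stepPrim {r : ℝ} (h : 2 ≤ r) : 1 ≤ stepPrim r := by
  have h1 : stepPrim r - stepPrim 1 = ∫ t in (1 : ℝ)..r, Real.smoothTransition t := by
    rw [stepPrim, stepPrim, integral_interval_sub_left (Real.smoothTransition.continuous.intervalIntegrable _ _)
      (Real.smoothTransition.continuous.intervalIntegrable _ _)]
  have h2 : ∫ t in (1 : ℝ)..r, Real.smoothTransition t = ∫ _ in (1 : ℝ)..r, (1 : ℝ) :=
    integral_congr fun t ht ↦ by
      rw [uIcc_of_le (by linarith)] at ht
      exact Real.smoothTransition.one_of_one_le ht.1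
  rw [h2, intervalIntegral.integral_const, smul_eq_mul, mul_one] at h1
  linarith [stepPrim_nonneg 1]

/-- **The convex majorant** `χ(r) = ∑_k c_k S(r - a - k)` (a locally finite sum). [folklore] -/
def majorant (a : ℝ) (c : ℕ → ℝ) (r : ℝ) : ℝ := ∑' k : ℕ, c k * stepPrim (r - a - k)

/-- The majorant as a finite sum on `(-∞, a + K)`. [folklore] -/
theorem majorant_eq_sum {a : ℝ} (c : ℕ → ℝ) {K : ℕ} {r : ℝ} (hr : r < a + K) :
    majorant a c r = ∑ k ∈ Finset.range K, c k * stepPrim (r - a - k) := by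
  refine tsum_eq_sum fun k hk ↦ ?_
  rw [Finset.mem_range, not_lt] at hk
  have hk' : (K : ℝ) ≤ k := by exact_mod_cast hk
  rw [stepPrim_of_nonpos (by linarith), mul_zero]

/-- The majorant agrees near `r₀` with a finite sum. [folklore] -/
theorem majorant_eventuallyEq (a : ℝ) (c : ℕ → ℝ) (r₀ : ℝ) :
    majorant a c =ᶠ[𝓝 r₀] fun r ↦ ∑ k ∈ Finset.range (⌈r₀ - a⌉₊ + 1), c k * stepPrim (r - a - k) := by
  have h0 : r₀ < a + (⌈r₀ - a⌉₊ + 1 : ℕ) := by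
    have := Nat.le_ceil (r₀ - a); push_cast; linarith
  filter_upwards [Iio_mem_nhds h0] with r hr
  exact majorant_eq_sum c hr

/-- The finite sums are `C^∞`. [folklore] -/
theorem contDiff_majorant_sum (a : ℝ) (c : ℕ → ℝ) (K : ℕ) :
    ContDiff ℝ ∞ fun r ↦ ∑ k ∈ Finset.range K, c k * stepPrim (r - a - k) :=
  ContDiff.sum fun k _ ↦ (contDiff_const (c := c k)).mul (contDiff_stepPrim.comp (contDiff_id.sub contDiff_const |>.sub contDiff_const))

/-- The majorant is `C^∞`. [folklore] -/
theorem contDiff_majorant (a : ℝ) (c : ℕ → ℝ) : ContDiff ℝ ∞ (majorant a c) :=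
  contDiff_iff_contDiffAt.2 fun r₀ ↦ ((contDiff_majorant_sum a c _).contDiffAt).congr_of_eventuallyEq (majorant_eventuallyEq a c r₀)

/-- The derivative of the finite sums. [folklore] -/
theorem deriv_majorant_sum (a : ℝ) (c : ℕ → ℝ) (K : ℕ) (r : ℝ) :
    deriv (fun r ↦ ∑ k ∈ Finset.range K, c k * stepPrim (r - a - k)) r =
      ∑ k ∈ Finset.range K, c k * Real.smoothTransition (r - a - k) := by
  have : ∀ k, HasDerivAt (fun r ↦ c k * stepPrim (r - a - k)) (c k * Real.smoothTransition (r - a - k)) r := fun k ↦ by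
    have h1 : HasDerivAt (fun r : ℝ ↦ r - a - k) 1 r := by
      simpa using ((hasDerivAt_id r).sub_const a).sub_const (k : ℝ)
    have h2 := (hasDerivAt_stepPrim (r - a - k)).comp r h1
    simpa using h2.const_mul (c k)
  exact (HasDerivAt.fun_sum fun k _ ↦ this k).deriv

/-- The derivative of the majorant near `r`. [folklore] -/
theorem deriv_majorant (a : ℝ) (c : ℕ → ℝ) (r : ℝ) :
    deriv (majorant a c) r = ∑ k ∈ Finset.range (⌈r - a⌉₊ + 1), c k * Real.smoothTransition (r - a - k) := by
  rw [(majorant_eventuallyEq a c r).deriv_eq, deriv_majorant_sum]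

/-- The derivative of the majorant as a function near `r₀`. [folklore] -/
theorem deriv_majorant_eventuallyEq (a : ℝ) (c : ℕ → ℝ) (r₀ : ℝ) :
    deriv (majorant a c) =ᶠ[𝓝 r₀] fun r ↦ ∑ k ∈ Finset.range (⌈r₀ - a⌉₊ + 1), c k * Real.smoothTransition (r - a - k) := by
  have h0 : r₀ < a + (⌈r₀ - a⌉₊ + 1 : ℕ) := by
    have := Nat.le_ceil (r₀ - a); push_cast; linarith
  filter_upwards [eventually_eventuallyEq_nhds.2 (majorant_eventuallyEq a c r₀)] with r hr
  rw [hr.deriv_eq, deriv_majorant_sum]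

/-- The second derivative of the majorant near `r`. [folklore] -/
theorem deriv_deriv_majorant (a : ℝ) (c : ℕ → ℝ) (r : ℝ) :
    deriv (deriv (majorant a c)) r = ∑ k ∈ Finset.range (⌈r - a⌉₊ + 1), c k * deriv Real.smoothTransition (r - a - k) := by
  rw [(deriv_majorant_eventuallyEq a c r).deriv_eq]
  have : ∀ k, HasDerivAt (fun r ↦ c k * Real.smoothTransition (r - a - k)) (c k * deriv Real.smoothTransition (r - a - k)) r :=
    fun k ↦ by
    have h1 : HasDerivAt (fun r : ℝ ↦ r - a - k) 1 r := by
      simpa using ((hasDerivAt_id r).sub_const a).sub_const (k : ℝ)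
    have h2 := ((Real.smoothTransition.contDiff (n := 1)).differentiable (by norm_num) (r - a - k)).hasDerivAt.comp r h1
    simpa using h2.const_mul (c k)
  exact (HasDerivAt.fun_sum fun k _ ↦ this k).deriv

/-- **Smooth convex majorants.** For every `a ∈ ℝ` and every sequence `c_k` there is a `C^∞`
function `χ : ℝ → ℝ`, vanishing on `(-∞, a]`, with `χ, χ', χ'' ≥ 0`, and `χ(r) ≥ c_k`, `χ'(r) ≥ c_k`
for `r ∈ [a + 2 + k, a + 3 + k]` («`χ` convex and so rapidly increasing that …», proof of Lemma
4.4.1). [cite: HormanderSCV1973, proof of Lemma 4.4.1 (p. 92)] -/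
theorem exists_smooth_convex_majorant (a : ℝ) (c : ℕ → ℝ) :
    ∃ χ : ℝ → ℝ, ContDiff ℝ ∞ χ ∧ (∀ r ≤ a, χ r = 0) ∧ (∀ r, 0 ≤ χ r) ∧ (∀ r, 0 ≤ deriv χ r) ∧
      (∀ r, 0 ≤ deriv (deriv χ) r) ∧
      ∀ (k : ℕ) (r : ℝ), a + 2 + k ≤ r → r ≤ a + 3 + k → c k ≤ χ r ∧ c k ≤ deriv χ r := by
  set c' : ℕ → ℝ := fun k ↦ max (c k) 0 with hc'
  have hc'0 : ∀ k, 0 ≤ c' k := fun k ↦ le_max_right _ _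
  refine ⟨majorant a c', contDiff_majorant a c', fun r hr ↦ ?_, fun r ↦ ?_, fun r ↦ ?_, fun r ↦ ?_, fun k r hkr hrk ↦ ⟨?_, ?_⟩⟩
  · rw [majorant]
    exact (tsum_congr fun k ↦ by
      rw [stepPrim_of_nonpos (by have := (Nat.cast_nonneg k : (0:ℝ) ≤ k); linarith), mul_zero]).trans tsum_zero
  · exact tsum_nonneg fun k ↦ mul_nonneg (hc'0 k) (stepPrim_nonneg _)
  · rw [deriv_majorant]
    exact Finset.sum_nonneg fun k _ ↦ mul_nonneg (hc'0 k) (Real.smoothTransition.nonneg _)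
  · rw [deriv_deriv_majorant]
    exact Finset.sum_nonneg fun k _ ↦ mul_nonneg (hc'0 k) Real.smoothTransition.monotone.deriv_nonneg
  · -- `χ(r) ≥ c'_k S(r - a - k) ≥ c'_k ≥ c_k`
    have hK : r < a + (⌈r - a⌉₊ + 1 : ℕ) := by have := Nat.le_ceil (r - a); push_cast; linarith
    rw [majorant_eq_sum c' hK]
    have hk : k ∈ Finset.range (⌈r - a⌉₊ + 1) := by
      rw [Finset.mem_range]
      have : (k : ℝ) < ⌈r - a⌉₊ + 1 := by have := Nat.le_ceil (r - a); linarith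
      exact_mod_cast this
    refine (le_max_left _ _).trans ((le_mul_of_one_le_right (hc'0 k) (one_le_stepPrim (by linarith))).trans
      (Finset.single_le_sum (f := fun k ↦ c' k * stepPrim (r - a - k)) (fun i _ ↦ mul_nonneg (hc'0 i) (stepPrim_nonneg _)) hk))
  · rw [deriv_majorant]
    have hk : k ∈ Finset.range (⌈r - a⌉₊ + 1) := by
      rw [Finset.mem_range]
      have : (k : ℝ) < ⌈r - a⌉₊ + 1 := by have := Nat.le_ceil (r - a); linarith
      exact_mod_cast this
    have h1 : c' k * Real.smoothTransition (r - a - k) = c' k := by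
      rw [Real.smoothTransition.one_of_one_le (by linarith), mul_one]
    calc c k ≤ c' k := le_max_left _ _
      _ = c' k * Real.smoothTransition (r - a - k) := h1.symm
      _ ≤ _ := Finset.single_le_sum (f := fun k ↦ c' k * Real.smoothTransition (r - a - k))
          (fun i _ ↦ mul_nonneg (hc'0 i) (Real.smoothTransition.nonneg _)) hk

end Majorant

/-! ### Flat chain rules for `χ ∘ u` -/

section ChainRule

variable {E' : Type*} [NormedAddCommGroup E'] [NormedSpace ℂ E']

/-- `D[χ ∘ U](z) w = χ'(U z) · D U(z) w` (read in `ℂ`). [folklore] -/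
theorem fderiv_ofReal_comp_apply {χ : ℝ → ℝ} {U : E' → ℝ} {z : E'} (hχ : DifferentiableAt ℝ χ (U z))
    (hU : DifferentiableAt ℝ U z) (w : E') :
    fderiv ℝ (fun y ↦ (χ (U y) : ℂ)) z w = ((deriv χ (U z) : ℝ) : ℂ) * fderiv ℝ (fun y ↦ (U y : ℂ)) z w := by
  have h1 : HasFDerivAt (fun y ↦ χ (U y)) ((ContinuousLinearMap.smulRight (1 : ℝ →L[ℝ] ℝ) (deriv χ (U z))).comp (fderiv ℝ U z)) z :=
    hχ.hasDerivAt.hasFDerivAt.comp z hU.hasFDerivAt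
  have h2 : HasFDerivAt (fun y ↦ (χ (U y) : ℂ)) (ofRealCLM.comp (((ContinuousLinearMap.smulRight (1 : ℝ →L[ℝ] ℝ)
      (deriv χ (U z))).comp (fderiv ℝ U z)))) z := ofRealCLM.hasFDerivAt.comp z h1
  have h3 : HasFDerivAt (fun y ↦ (U y : ℂ)) (ofRealCLM.comp (fderiv ℝ U z)) z := ofRealCLM.hasFDerivAt.comp z hU.hasFDerivAt
  rw [h2.fderiv, h3.fderiv]
  simp only [ContinuousLinearMap.coe_comp, comp_apply, ContinuousLinearMap.smulRight_apply,
    one_apply_eq_self, smul_eq_mul, ofRealCLM_apply, ofReal_mul]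
  ring

/-- `∂̄_v (χ ∘ U) = χ'(U) ∂̄_v U`. [folklore] -/
theorem dbarAlong_ofReal_comp {χ : ℝ → ℝ} {U : E' → ℝ} {z : E'} (hχ : DifferentiableAt ℝ χ (U z))
    (hU : DifferentiableAt ℝ U z) (v : E') :
    dbarAlong v (fun y ↦ (χ (U y) : ℂ)) z = ((deriv χ (U z) : ℝ) : ℂ) * dbarAlong v (fun y ↦ (U y : ℂ)) z := by
  rw [dbarAlong_apply, dbarAlong_apply, fderiv_ofReal_comp_apply hχ hU, fderiv_ofReal_comp_apply hχ hU, smul_eq_mul, smul_eq_mul]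
  ring

/-- `∂_v (χ ∘ U) = χ'(U) ∂_v U`. [folklore] -/
theorem delAlong_ofReal_comp {χ : ℝ → ℝ} {U : E' → ℝ} {z : E'} (hχ : DifferentiableAt ℝ χ (U z))
    (hU : DifferentiableAt ℝ U z) (v : E') :
    delAlong v (fun y ↦ (χ (U y) : ℂ)) z = ((deriv χ (U z) : ℝ) : ℂ) * delAlong v (fun y ↦ (U y : ℂ)) z := by
  rw [delAlong_apply, delAlong_apply, fderiv_ofReal_comp_apply hχ hU, fderiv_ofReal_comp_apply hχ hU, smul_eq_mul, smul_eq_mul]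
  ring

variable {ι : Type} [Fintype ι] {D : RiemannDomain ι}
variable {χ : ℝ → ℝ} {u : D → ℝ}

/-- **`∂̄_v (χ ∘ u) = χ'(u) ∂̄_v u` on a Riemann domain.** [folklore] -/
theorem dbar_ofReal_comp (hχ : Differentiable ℝ χ) (hu : ContMDiff 𝓘(ℝ, ι → ℂ) 𝓘(ℝ, ℝ) ∞ u) (v : ι → ℂ) (x : D) :
    dbar v (fun y ↦ (χ (u y) : ℂ)) x = ((deriv χ (u x) : ℝ) : ℂ) * dbar v (fun y ↦ (u y : ℂ)) x := by
  have hU : DifferentiableAt ℝ (u ∘ (D.chart x).symm) (D.proj x) :=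
    (contMDiffAt_iff_contDiffAt.1 (hu x)).differentiableAt (by simp)
  rw [dbar, dbar]
  have h1 : ((fun y ↦ (χ (u y) : ℂ)) ∘ (D.chart x).symm) = fun z ↦ (χ ((u ∘ (D.chart x).symm) z) : ℂ) := rfl
  have h2 : ((fun y ↦ (u y : ℂ)) ∘ (D.chart x).symm) = fun z ↦ ((u ∘ (D.chart x).symm) z : ℂ) := rfl
  rw [h1, h2, dbarAlong_ofReal_comp (hχ _) hU]
  simp only [comp_apply, D.chart_symm_proj]

/-- **`∂_v (χ ∘ u) = χ'(u) ∂_v u` on a Riemann domain.** [folklore] -/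
theorem del_ofReal_comp (hχ : Differentiable ℝ χ) (hu : ContMDiff 𝓘(ℝ, ι → ℂ) 𝓘(ℝ, ℝ) ∞ u) (v : ι → ℂ) (x : D) :
    del v (fun y ↦ (χ (u y) : ℂ)) x = ((deriv χ (u x) : ℝ) : ℂ) * del v (fun y ↦ (u y : ℂ)) x := by
  have hU : DifferentiableAt ℝ (u ∘ (D.chart x).symm) (D.proj x) :=
    (contMDiffAt_iff_contDiffAt.1 (hu x)).differentiableAt (by simp)
  rw [del, del]
  have h1 : ((fun y ↦ (χ (u y) : ℂ)) ∘ (D.chart x).symm) = fun z ↦ (χ ((u ∘ (D.chart x).symm) z) : ℂ) := rfl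
  have h2 : ((fun y ↦ (u y : ℂ)) ∘ (D.chart x).symm) = fun z ↦ ((u ∘ (D.chart x).symm) z : ℂ) := rfl
  rw [h1, h2, delAlong_ofReal_comp (hχ _) hU]
  simp only [comp_apply, D.chart_symm_proj]

/-- `χ ∘ u` is `C^∞` for `χ, u` `C^∞`. [folklore] -/
theorem contMDiff_comp_real (hχ : ContDiff ℝ ∞ χ) (hu : ContMDiff 𝓘(ℝ, ι → ℂ) 𝓘(ℝ, ℝ) ∞ u) :
    ContMDiff 𝓘(ℝ, ι → ℂ) 𝓘(ℝ, ℝ) ∞ fun y ↦ χ (u y) :=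
  hχ.comp_contMDiff hu

/-- **The Levi form of `χ ∘ u`**: `∂_a ∂̄_b (χ ∘ u) = χ''(u) ∂_a u ∂̄_b u + χ'(u) ∂_a ∂̄_b u`. [folklore] -/
theorem del_dbar_ofReal_comp (hχ : ContDiff ℝ ∞ χ) (hu : ContMDiff 𝓘(ℝ, ι → ℂ) 𝓘(ℝ, ℝ) ∞ u) (a b : ι → ℂ) (x : D) :
    del a (dbar b (fun y ↦ (χ (u y) : ℂ))) x =
      ((deriv (deriv χ) (u x) : ℝ) : ℂ) * del a (fun y ↦ (u y : ℂ)) x * dbar b (fun y ↦ (u y : ℂ)) x +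
        ((deriv χ (u x) : ℝ) : ℂ) * del a (dbar b (fun y ↦ (u y : ℂ))) x := by
  have hχ' : ContDiff ℝ ∞ (deriv χ) := (contDiff_infty_iff_deriv.1 hχ).2
  have hχd : Differentiable ℝ χ := (contDiff_infty_iff_deriv.1 hχ).1
  have hχ'd : Differentiable ℝ (deriv χ) := (contDiff_infty_iff_deriv.1 hχ').1
  have h1 : dbar b (fun y ↦ (χ (u y) : ℂ)) = fun y ↦ ((deriv χ (u y) : ℝ) : ℂ) * dbar b (fun y ↦ (u y : ℂ)) y :=
    funext fun y ↦ dbar_ofReal_comp hχd hu b y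
  rw [h1, del_mul_apply (contMDiff_ofReal (contMDiff_comp_real hχ' hu)) (contMDiff_dbar (contMDiff_ofReal hu) b) a x,
    del_ofReal_comp hχ'd hu a x]
  ring

/-- **Plurisubharmonicity of convex increasing functions of `u`**: for `χ'' ≥ 0`,
`Re ∑ ∂_j∂̄_k(χ∘u) v_j v̄_k = χ''(u) |∑ ∂_j u v_j|² + χ'(u) Re ∑ u_{jk̄} v_j v̄_k ≥ χ'(u) Re ∑ u_{jk̄} v_j v̄_k`.
[cite: HormanderSCV1973, proof of Lemma 4.4.1 (p. 92)] -/
theorem mul_re_levi_le_re_levi_comp [DecidableEq ι] (hχ : ContDiff ℝ ∞ χ) (hχ2 : ∀ r, 0 ≤ deriv (deriv χ) r)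
    (hu : ContMDiff 𝓘(ℝ, ι → ℂ) 𝓘(ℝ, ℝ) ∞ u) (x : D) (v : ι → ℂ) :
    deriv χ (u x) * (∑ j, ∑ k, del (Pi.single j 1) (dbar (Pi.single k 1) (fun y ↦ (u y : ℂ))) x * v j * conj (v k)).re ≤
      (∑ j, ∑ k, del (Pi.single j 1) (dbar (Pi.single k 1) (fun y ↦ (χ (u y) : ℂ))) x * v j * conj (v k)).re := by
  simp_rw [del_dbar_ofReal_comp hχ hu]
  set A : ℂ := ((deriv (deriv χ) (u x) : ℝ) : ℂ) with hA
  set B : ℂ := ((deriv χ (u x) : ℝ) : ℂ) with hB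
  set d : ι → ℂ := fun j ↦ del (Pi.single j 1) (fun y ↦ (u y : ℂ)) x with hd
  set L : ι → ι → ℂ := fun j k ↦ del (Pi.single j 1) (dbar (Pi.single k 1) (fun y ↦ (u y : ℂ))) x with hL
  have hconj : ∀ k, dbar (Pi.single k 1) (fun y ↦ (u y : ℂ)) x = conj (d k) := fun k ↦ Weights.dbar_ofReal_eq_conj_del u _ x
  simp_rw [hconj]
  set P : ℂ := ∑ j, d j * v j with hP
  have hsplit : ∑ j, ∑ k, (A * d j * conj (d k) + B * L j k) * v j * conj (v k) =
      A * (P * conj P) + B * ∑ j, ∑ k, L j k * v j * conj (v k) := by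
    have e1 : ∑ j, ∑ k, (A * d j * conj (d k) + B * L j k) * v j * conj (v k) =
        ∑ j, ∑ k, A * ((d j * v j) * conj (d k * v k)) + ∑ j, ∑ k, B * (L j k * v j * conj (v k)) := by
      rw [← Finset.sum_add_distrib]
      refine Finset.sum_congr rfl fun j _ ↦ ?_
      rw [← Finset.sum_add_distrib]
      exact Finset.sum_congr rfl fun k _ ↦ by rw [map_mul]; ring
    rw [e1, hP, _root_.map_sum, Finset.sum_mul_sum, Finset.mul_sum, Finset.mul_sum]
    congr 1
    · exact Finset.sum_congr rfl fun j _ ↦ by rw [Finset.mul_sum]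
    · exact Finset.sum_congr rfl fun j _ ↦ by rw [Finset.mul_sum]
  change B.re * (∑ j, ∑ k, L j k * v j * conj (v k)).re ≤ (∑ j, ∑ k, (A * d j * conj (d k) + B * L j k) * v j * conj (v k)).re
  rw [hsplit, add_re, mul_conj', hA, hB]
  have h1 : (((deriv (deriv χ) (u x) : ℝ) : ℂ) * ((‖P‖ : ℝ) : ℂ) ^ 2).re = deriv (deriv χ) (u x) * ‖P‖ ^ 2 := by
    rw [← ofReal_pow, ← ofReal_mul, ofReal_re]
  have h2 : (((deriv χ (u x) : ℝ) : ℂ) * ∑ j, ∑ k, L j k * v j * conj (v k)).re = deriv χ (u x) * (∑ j, ∑ k, L j k * v j * conj (v k)).re :=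
    re_ofReal_mul _ _
  rw [h1, h2, ofReal_re]
  nlinarith [hχ2 (u x), sq_nonneg ‖P‖]

/-- **The Levi form is additive**: `∂_a ∂̄_b (φ + w) = ∂_a ∂̄_b φ + ∂_a ∂̄_b w` for smooth `φ, w`. [folklore] -/
theorem del_dbar_add {φ w : D → ℂ} (hφ : ContMDiff 𝓘(ℝ, ι → ℂ) 𝓘(ℝ, ℂ) ∞ φ) (hw : ContMDiff 𝓘(ℝ, ι → ℂ) 𝓘(ℝ, ℂ) ∞ w)
    (a b : ι → ℂ) (x : D) :
    del a (dbar b (fun y ↦ φ y + w y)) x = del a (dbar b φ) x + del a (dbar b w) x := by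
  have h1 : dbar b (fun y ↦ φ y + w y) = dbar b φ + dbar b w := by
    funext y
    rw [show (fun y ↦ φ y + w y) = φ + w from rfl,
      dbar_add (differentiableAt_comp_symm_of_contMDiff hφ y) (differentiableAt_comp_symm_of_contMDiff hw y)]
    rfl
  rw [h1, del_add (differentiableAt_comp_symm_of_contMDiff (contMDiff_dbar hφ b) x)
    (differentiableAt_comp_symm_of_contMDiff (contMDiff_dbar hw b) x)]

end ChainRule

/-! ### Cut-offs and the auxiliary function `ψ` from an exhaustion function -/

section Exhaustion

variable {ι : Type} [Fintype ι] {D : RiemannDomain ι}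
variable {s : D → ℝ} (hs : ContMDiff 𝓘(ℝ, ι → ℂ) 𝓘(ℝ, ℝ) ∞ s) (hsK : ∀ b : ℝ, IsCompact {x | s x ≤ b})

/-- The squared flat gradient `N = ∑_k |∂_k s|²` of a real function. [folklore] -/
def gradSq [DecidableEq ι] (s : D → ℝ) (x : D) : ℝ := ∑ k, ‖del (Pi.single k 1) (fun y ↦ (s y : ℂ)) x‖ ^ 2

/-- `N ≥ 0`. [folklore] -/
theorem gradSq_nonneg [DecidableEq ι] (s : D → ℝ) (x : D) : 0 ≤ gradSq s x := Finset.sum_nonneg fun _ _ ↦ sq_nonneg _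

include hs in
/-- `N` is `C^∞` for `s` smooth. [folklore] -/
theorem contMDiff_gradSq [DecidableEq ι] : ContMDiff 𝓘(ℝ, ι → ℂ) 𝓘(ℝ, ℝ) ∞ (gradSq s) :=
  contMDiff_finsetSum fun k _ ↦ (contDiff_norm_sq ℝ (n := ∞)).comp_contMDiff (contMDiff_del (contMDiff_ofReal hs) (Pi.single k 1))

/-- **A bound for `σ'`** (`σ` = `Real.smoothTransition`): `|σ'| ≤ C_σ`, and `σ' = 0` off `(0, 1)`.
[folklore] -/
theorem exists_bound_deriv_smoothTransition :
    ∃ C : ℝ, 0 < C ∧ (∀ t, |deriv Real.smoothTransition t| ≤ C) ∧ ∀ t, (t ≤ 0 ∨ 1 ≤ t) → deriv Real.smoothTransition t = 0 := by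
  have hd : Continuous (deriv Real.smoothTransition) := (Real.smoothTransition.contDiff (n := 1)).continuous_deriv le_rfl
  have h0 : ∀ t, (t ≤ 0 ∨ 1 ≤ t) → deriv Real.smoothTransition t = 0 := by
    -- `σ` is monotone with values in `[0,1]`, attaining its minimum on `(-∞,0]` and its maximum on `[1,∞)`
    intro t ht
    rcases ht with ht | ht
    · have hmin : IsLocalMin Real.smoothTransition t := Filter.Eventually.of_forall fun y ↦ by
        rw [Real.smoothTransition.zero_of_nonpos ht]; exact Real.smoothTransition.nonneg y
      exact hmin.deriv_eq_zero
    · have hmax : IsLocalMax Real.smoothTransition t := Filter.Eventually.of_forall fun y ↦ by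
        rw [Real.smoothTransition.one_of_one_le ht]; exact Real.smoothTransition.le_one y
      exact hmax.deriv_eq_zero
  have hc : HasCompactSupport (deriv Real.smoothTransition) := by
    refine HasCompactSupport.intro (isCompact_Icc (a := (0 : ℝ)) (b := 1)) fun t ht ↦ h0 t ?_
    rw [mem_Icc, not_and_or, not_le, not_le] at ht
    exact ht.imp le_of_lt le_of_lt
  obtain ⟨C, hC⟩ := hd.bounded_above_of_compact_support hc
  refine ⟨max C 1, lt_max_of_lt_right one_pos, fun t ↦ ?_, h0⟩
  rw [← Real.norm_eq_abs]; exact (hC t).trans (le_max_left _ _)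

variable (s) in
/-- **Hörmander's cut-offs from an exhaustion function**: `η_ν = σ(ν + a + 4 - s)`, equal to `1` on
`{s ≤ ν + a + 3}` and to `0` on `{s ≥ ν + a + 4}`. [cite: HormanderSCV1973, §4.2 (4.2.1) and proof of Lemma 4.4.1] -/
def exhaustionCutoff (a : ℝ) (ν : ℕ) (x : D) : ℝ := Real.smoothTransition (ν + a + 4 - s x)

variable (s) in
/-- **Hörmander's auxiliary function** `ψ_a = σ(s - a - 2) log(1 + C N)`, `N = ∑_k |∂_k s|²`: smooth,
`≥ 0`, `= 0` on `{s ≤ a + 2}`, `= log(1 + C N)` on `{s ≥ a + 3}`. [cite: HormanderSCV1973, §4.2 (4.2.2) and proof of Lemma 4.4.1] -/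
def exhaustionPsi [DecidableEq ι] (a C : ℝ) (x : D) : ℝ := Real.smoothTransition (s x - a - 2) * Real.log (1 + C * gradSq s x)

include hs in
/-- The cut-offs are `C^∞`. [folklore] -/
theorem contMDiff_exhaustionCutoff (a : ℝ) (ν : ℕ) : ContMDiff 𝓘(ℝ, ι → ℂ) 𝓘(ℝ, ℝ) ∞ (exhaustionCutoff s a ν) :=
  Real.smoothTransition.contDiff.comp_contMDiff (contMDiff_const.sub hs)

include hsK in
/-- The cut-offs have compact support (inside `{s ≤ ν + a + 4}`). [folklore] -/
theorem hasCompactSupport_exhaustionCutoff (a : ℝ) (ν : ℕ) : HasCompactSupport (exhaustionCutoff s a ν) :=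
  HasCompactSupport.intro (hsK (ν + a + 4)) fun x hx ↦ Real.smoothTransition.zero_of_nonpos (by
    have hx' : ¬ s x ≤ ν + a + 4 := hx
    linarith [not_le.1 hx'])

/-- The cut-offs take values in `[0, 1]`. [folklore] -/
theorem exhaustionCutoff_mem_Icc (a : ℝ) (ν : ℕ) (x : D) : exhaustionCutoff s a ν x ∈ Icc (0 : ℝ) 1 :=
  ⟨Real.smoothTransition.nonneg _, Real.smoothTransition.le_one _⟩

include hs in
/-- The cut-offs are eventually `1` near every point. [folklore] -/
theorem eventually_exhaustionCutoff_eq_one (a : ℝ) (x : D) :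
    ∀ᶠ ν : ℕ in atTop, ∀ᶠ y in 𝓝 x, exhaustionCutoff s a ν y = 1 := by
  filter_upwards [eventually_ge_atTop ⌈s x - a - 2⌉₊] with ν hν
  have hν' : s x - a - 2 ≤ ν := (Nat.le_ceil _).trans (by exact_mod_cast hν)
  have hopen : IsOpen {y : D | s y < ν + a + 3} := isOpen_lt hs.continuous continuous_const
  filter_upwards [hopen.mem_nhds (show s x < ν + a + 3 by linarith)] with y hy
  have hy' : s y < ν + a + 3 := hy
  exact Real.smoothTransition.one_of_one_le (by linarith)

include hs in
/-- `∂̄_k η_ν = -σ'(ν + a + 4 - s) ∂̄_k s`. [folklore] -/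
theorem dbar_exhaustionCutoff [DecidableEq ι] (a : ℝ) (ν : ℕ) (v : ι → ℂ) (x : D) :
    dbar v (fun y ↦ (exhaustionCutoff s a ν y : ℂ)) x =
      -((deriv Real.smoothTransition (ν + a + 4 - s x) : ℝ) : ℂ) * dbar v (fun y ↦ (s y : ℂ)) x := by
  have hσ : Differentiable ℝ fun t : ℝ ↦ Real.smoothTransition (ν + a + 4 - t) :=
    ((Real.smoothTransition.contDiff (n := 1)).differentiable one_ne_zero).comp ((differentiable_const _).sub differentiable_id)
  have h := dbar_ofReal_comp (χ := fun t ↦ Real.smoothTransition (ν + a + 4 - t)) hσ hs v x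
  simp only [exhaustionCutoff] at h ⊢
  rw [h]
  congr 1
  have : deriv (fun t : ℝ ↦ Real.smoothTransition (ν + a + 4 - t)) (s x) = -deriv Real.smoothTransition (ν + a + 4 - s x) := by
    rw [deriv_comp_const_sub]
  rw [this, ofReal_neg]

include hs in
/-- **The gradient bound for the cut-offs**: `∑_k |∂̄_k η_ν|² ≤ C_σ² N`, and `= 0` where
`s ≤ ν + a + 3` (in particular where `s ≤ a + 3`). [cite: HormanderSCV1973, §4.2 (4.2.2)] -/
theorem sum_norm_dbar_exhaustionCutoff_sq_le [DecidableEq ι] {C : ℝ} (hC : ∀ t, |deriv Real.smoothTransition t| ≤ C)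
    (hC0 : ∀ t, (t ≤ 0 ∨ 1 ≤ t) → deriv Real.smoothTransition t = 0) (a : ℝ) (ν : ℕ) (x : D) :
    ∑ k, ‖dbar (Pi.single k 1) (fun y ↦ (exhaustionCutoff s a ν y : ℂ)) x‖ ^ 2 ≤ C ^ 2 * gradSq s x ∧
      (s x ≤ ν + a + 3 → ∑ k, ‖dbar (Pi.single k 1) (fun y ↦ (exhaustionCutoff s a ν y : ℂ)) x‖ ^ 2 = 0) := by
  simp_rw [dbar_exhaustionCutoff hs, norm_mul, norm_neg, norm_real, Real.norm_eq_abs, mul_pow, ← Finset.mul_sum, gradSq]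
  have hN : ∑ k, ‖dbar (Pi.single k 1) (fun y ↦ (s y : ℂ)) x‖ ^ 2 = ∑ k, ‖del (Pi.single k 1) (fun y ↦ (s y : ℂ)) x‖ ^ 2 :=
    Finset.sum_congr rfl fun k _ ↦ by rw [Weights.dbar_ofReal_eq_conj_del, norm_conj]
  rw [hN]
  refine ⟨mul_le_mul_of_nonneg_right (pow_le_pow_left₀ (abs_nonneg _) (hC _) 2) (gradSq_nonneg s x), fun hx ↦ ?_⟩
  rw [hC0 _ (Or.inr (by linarith)), abs_zero]
  ring

include hs in
/-- `ψ_a` is `C^∞` (for `C ≥ 0`). [folklore] -/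
theorem contMDiff_exhaustionPsi [DecidableEq ι] (a : ℝ) {C : ℝ} (hC : 0 ≤ C) : ContMDiff 𝓘(ℝ, ι → ℂ) 𝓘(ℝ, ℝ) ∞ (exhaustionPsi s a C) := by
  have h1 : ContMDiff 𝓘(ℝ, ι → ℂ) 𝓘(ℝ, ℝ) ∞ fun x ↦ Real.smoothTransition (s x - a - 2) :=
    Real.smoothTransition.contDiff.comp_contMDiff ((hs.sub contMDiff_const).sub contMDiff_const)
  have h2 : ContMDiff 𝓘(ℝ, ι → ℂ) 𝓘(ℝ, ℝ) ∞ fun x ↦ Real.log (1 + C * gradSq s x) := by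
    -- chartwise: `log ∘ (1 + C N ∘ chart⁻¹)` with a positive argument
    rw [contMDiff_iff]
    intro x
    have hN := (contMDiff_iff.1 (contMDiff_gradSq hs)) x
    have : (fun y ↦ Real.log (1 + C * gradSq s y)) ∘ (D.chart x).symm = fun z ↦ Real.log (1 + C * (gradSq s ∘ (D.chart x).symm) z) := rfl
    rw [this]
    exact (contDiffOn_const.add (contDiffOn_const.mul hN)).log fun z _ ↦
      (add_pos_of_pos_of_nonneg one_pos (mul_nonneg hC (gradSq_nonneg s _))).ne'
  exact h1.mul h2

/-- `ψ_a ≥ 0` (for `C ≥ 0`). [folklore] -/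
theorem exhaustionPsi_nonneg [DecidableEq ι] (a : ℝ) {C : ℝ} (hC : 0 ≤ C) (x : D) : 0 ≤ exhaustionPsi s a C x :=
  mul_nonneg (Real.smoothTransition.nonneg _) (Real.log_nonneg (by nlinarith [gradSq_nonneg s x]))

/-- `ψ_a = 0` on `{s ≤ a + 2}`. [folklore] -/
theorem exhaustionPsi_eq_zero [DecidableEq ι] (a C : ℝ) {x : D} (hx : s x ≤ a + 2) : exhaustionPsi s a C x = 0 := by
  rw [exhaustionPsi, Real.smoothTransition.zero_of_nonpos (by linarith), zero_mul]

/-- `e^{ψ_a} ≥ C N` on `{s ≥ a + 3}` (for `C ≥ 0`). [folklore] -/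
theorem mul_gradSq_le_exp_exhaustionPsi [DecidableEq ι] (a : ℝ) {C : ℝ} (hC : 0 ≤ C) {x : D} (hx : a + 3 ≤ s x) :
    C * gradSq s x ≤ Real.exp (exhaustionPsi s a C x) := by
  rw [exhaustionPsi, Real.smoothTransition.one_of_one_le (by linarith), one_mul,
    Real.exp_log (by nlinarith [gradSq_nonneg s x])]
  linarith

include hs in
/-- **(4.2.2) for the exhaustion cut-offs**: `∑_k |∂̄_k η_ν|² ≤ e^{ψ_a}` for all `ν` and all points,
with `C = C_σ²`. [cite: HormanderSCV1973, §4.2 (4.2.2); proof of Lemma 4.4.1] -/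
theorem sum_norm_dbar_exhaustionCutoff_sq_le_exp [DecidableEq ι] {C : ℝ} (hC : ∀ t, |deriv Real.smoothTransition t| ≤ C)
    (hC0 : ∀ t, (t ≤ 0 ∨ 1 ≤ t) → deriv Real.smoothTransition t = 0) (a : ℝ) (ν : ℕ) (x : D) :
    ∑ k, ‖dbar (Pi.single k 1) (fun y ↦ (exhaustionCutoff s a ν y : ℂ)) x‖ ^ 2 ≤ Real.exp (exhaustionPsi s a (C ^ 2) x) := by
  obtain ⟨h1, h2⟩ := sum_norm_dbar_exhaustionCutoff_sq_le hs hC hC0 a ν x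
  rcases le_or_gt (s x) (a + 3) with hx | hx
  · rw [h2 (hx.trans (by have := (Nat.cast_nonneg ν : (0 : ℝ) ≤ ν); linarith))]
    exact (Real.exp_pos _).le
  · exact h1.trans (mul_gradSq_le_exp_exhaustionPsi a (sq_nonneg C) hx.le)

end Exhaustion


end RiemannDomain

end Literature.Analysis.Complex
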